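import Literature.NumberTheory.Transcendental.ZilberFieldGSGC
import Literature.NumberTheory.Transcendental.ZilberFieldCCP
import Literature.NumberTheory.Transcendental.ZilberFieldTransport
import HarnessLib

/-!
# Zilber's existence theorem: Kirby's scheme ⟹ SEAC, and the reduction to Bays–Kirby's Thm 9.1

Sibling proof file of `Literature/NumberTheory/Transcendental/ZilberField.lean` for the named
facts

* `Literature.NumberTheory.Transcendental.kirby2013_isStronglyExpAlgClosed_iff_isLinIndepExpAlgClosed`
  (J. Kirby, *A note on the axioms for Zilber's pseudo-exponential fields*, Notre Dame J. Formal
  Logic 54 (2013) 509–520, arXiv:1006.0894, §2.3, Proposition "Axiom 4 (SEAC) is first-order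
  expressible modulo axioms 1, 2, and 3" — mathematical content of the proof: modulo axioms 1–3,
  strong exponential-algebraic closedness in Zilber's *genericity* form is equivalent to the
  *linear-independence* scheme), which is **discharged** here:
  `kirby2013_isStronglyExpAlgClosed_iff_isLinIndepExpAlgClosed_holds`;
* `Literature.NumberTheory.Transcendental.exists_isZilberField_of_aleph0_lt` (B. Zilber, Ann. Pure
  Appl. Logic 132 (2005); complete proof M. Bays, J. Kirby, Algebra & Number Theory 12 (2018),
  Thm 1.2 = Thm 9.1: a Zilber field of every uncountable cardinality), which is **reduced** here
  to the existence half of Bays–Kirby's Theorem 9.1 *in its printed axiom form*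
  (`exists_isZilberField_of_aleph0_lt_of_thm91`).

## Why the first is needed for the second

Bays–Kirby 2018, Thm 9.1 (arXiv v4 p. 28) lists the axioms `ECF_{SK,CCP}` as: 1 ELA-field;
2 standard kernel; 3 Schanuel property; 4 strong exponential-algebraic closedness in the form
"there is `x̄` in `F` such that `(x̄, e^x̄) ∈ V` and `x̄` is `ℚ`-linearly independent over `ā`" —
this is Kirby's scheme `IsLinIndepExpAlgClosed`, NOT the genericity form
`IsStronglyExpAlgClosed` of Zilber 2005 / Kirby 2013 §2 axiom 4 ("`(x̄, e^x̄) ∈ V` and is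
generic in `V` over `ā`") used by the tree's `IsZilberField`; 5 the countable closure property
for finite sets. So any proof of `exists_isZilberField_of_aleph0_lt` along Bays–Kirby's
construction (countable model `M(SK)`, Thm 5.9; quasiminimal pregeometry structure, Thm 6.9;
models of all uncountable cardinalities, Fact 6.4 = BHHKK 2014 Thm 2.3 / Kirby 2010 Thm 4.2;
axioms, Thm 8.2) ends with the passage scheme ⟹ SEAC, i.e. with Kirby 2013 §2.3.

## The proof of Kirby's Proposition (direction scheme ⟹ SEAC), as printed

"Now let `V` be any rotund, additively and multiplicatively free subvariety of `Gⁿ` defined over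
`F` and of dimension `n`, and `ā` be a finite tuple from `F` … Using axiom 3, by extending `ā` if
necessary, we may assume that `δ(ȳ/ā) ≥ 0` for all tuples `ȳ` from `F`, and also that `V` is
defined over `ā`. Now invoke the axiom scheme to find an `x̄`. We have `ldim_ℚ(x̄/ā) = n`, so we
must have `td(x̄, e^x̄/ā, e^ā) ≥ n`. But `dim V = n`, so `(x̄, e^x̄)` must be generic in `V` over
`(ā, e^ā)`, so a fortiori over `ā`." (arXiv:1006.0894, §2.3, proof of the Proposition.)

In the tree's vocabulary (`GammaFields.lean`): the zero subspace is strong by the Schanuel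
property (`ZilberHomogeneity.isStrong_bot_of_schanuelProperty`), so `span_ℚ(A ∪ F₀)` has a hull
`X ◁ F` spanned by a finite `T` (`GammaField.IsStrong.exists_isStrong`); the scheme applied to `T`
gives `(x, eˣ) ∈ W` with `x` linearly independent over `X`, whence `td(x/X) ≥ n` by strongness;
`W` being defined over `k = ℚ(A ∪ F₀) ⊆ acl(X ∪ exp X)`, the prime `P = I(W) ∩ k[X, Y]` has
`dim k[X, Y]/P = dim W = n` (`I(W)` is the unique minimal prime over `P·F[X, Y]`,
`LocusComponents.ringKrullDim_quotient_eq_of_mem_minimalPrimes_map`), and a zero of `P` of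
transcendence degree `≥ n` over `k` is generic (`LocusComponents.isGenericPt_of_trdeg_le`).
Only axioms 1 (algebraic closedness) and 3 are used; surjectivity of `exp` and the standard kernel,
hypotheses of the named fact, are not needed for this direction. The direction SEAC ⟹ scheme is
`IsStronglyExpAlgClosed.isLinIndepExpAlgClosed` (`ZilberField.lean`).

## Contents

* `IsLinIndepExpAlgClosed.isStronglyExpAlgClosed`,
  `kirby2013_isStronglyExpAlgClosed_iff_isLinIndepExpAlgClosed_holds` — Kirby 2013 §2.3.
* `schanuelProperty_of_isStrong_bot`, `schanuelProperty_iff_isStrong_bot` — the Schanuel property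
  is `0 ◁ F` (converse of `ZilberHomogeneity.isStrong_bot_of_schanuelProperty`), with the bridge
  `le_trdeg_adjoin_of_natCast_le_eRk` (rank in the algebraic matroid versus `Algebra.trdeg`).
* `isStrong_bot_of_isStrong_span_kernelGenerator`, `isStrong_span_kernelGenerator_of_isStrong_bot`,
  `schanuelProperty_iff_isStrong_span_kernelGenerator` — for `τ` a transcendental kernel
  generator, `ℚτ ◁ F` iff `0 ◁ F` iff the Schanuel property (Bays–Kirby 2018, proof of Thm 9.1:
  axiom 3 of Thm 8.2 versus axiom 3 of Thm 9.1), from `predim_bot_span_kernelGenerator`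
  (`δ(ℚτ/0) = 0`) and `predim_sup_span_kernelElement_le` (`δ(Y + ℚτ/Y) ≤ 0`).
* `IsZilberField.of_thm91_axioms`, `IsZilberField.of_isStrong_span_kernelGenerator`,
  `isLinIndepExpAlgClosed_of_base` — Zilber fields from the printed axioms of Thm 9.1, resp. of
  Thm 8.2 over the base `SK`.
* `exists_isZilberField_of_aleph0_lt_of_thm91`, `exists_isZilberField_of_aleph0_lt_of_largeModels`
  — the reductions of the named existence fact to Bays–Kirby's Thm 9.1 as printed, resp. to the
  output of the large-model construction (Thm 8.2-form axioms over the base `SK`).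

## References

* J. Kirby, *A note on the axioms for Zilber's pseudo-exponential fields*, Notre Dame J. Formal
  Logic 54 (2013) 509–520, arXiv:1006.0894: §2 (axioms 1–5), §2.3 Proposition and its proof.
* M. Bays, J. Kirby, *Pseudo-exponential maps, variants, and quasiminimality*, Algebra & Number
  Theory 12 (2018) 493–549, arXiv:1512.04262: Thm 1.2 (p. 3), Thm 8.2 (p. 26), §9.1 and
  Thm 9.1 with its proof (p. 28).
* B. Zilber, *Pseudo-exponentiation on algebraically closed fields of characteristic zero*,
  Ann. Pure Appl. Logic 132 (2005) 67–95, Thm 1.1.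
-/

noncomputable section

open Set MvPolynomial Cardinal
open Literature.ModelTheory.ExponentialFields Literature.ModelTheory.ExponentialFields.ExponentialRing

universe u

namespace Literature.NumberTheory.Transcendental

/-! ### Kirby 2013, §2.3: the linear-independence scheme implies SEAC -/

section Kirby2013

open GammaField

variable {K : Type u} [Field K] [CharZero K] [ExponentialRing K]

omit [CharZero K] [ExponentialRing K] in
/-- A closed set defined over a subfield `F₁` is defined over every larger subfield `F₂`, in the
coefficientwise form of `isDefinedOver_iff_exists_subset_range`: it is cut out by polynomials
over `K` lying in the range of `F₂[X] → K[X]`. [folklore] -/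
theorem IsDefinedOver.exists_subset_range_of_le {ι : Type*} {F₁ F₂ : Subfield K} (hle : F₁ ≤ F₂)
    {S : Set (ι → K)} (h : IsDefinedOver F₁ S) :
    ∃ T : Set (MvPolynomial ι K), T ⊆ Set.range (map (algebraMap F₂ K)) ∧
      S = {z | ∀ p ∈ T, aeval z p = 0} := by
  obtain ⟨T, hT, hS⟩ := isDefinedOver_iff_exists_subset_range.1 h
  refine ⟨T, fun p hp => ?_, hS⟩
  obtain ⟨p₀, rfl⟩ := hT hp
  refine ⟨MvPolynomial.map (Subfield.inclusion hle) p₀, ?_⟩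
  rw [MvPolynomial.map_map]
  rfl

/-- **Kirby 2013, §2.3, Proposition — direction "scheme ⟹ axiom 4"**: an algebraically closed
exponential field of characteristic zero with the Schanuel property which satisfies Kirby's
linear-independence scheme `IsLinIndepExpAlgClosed` is strongly exponentially-algebraically
closed (genericity form). Proof as printed: extend `ā` to a tuple spanning a strong subspace
(axiom 3), apply the scheme, and read genericity off `td ≥ n = dim V`.
[cite: Kirby2013Axioms, §2.3, Proposition (proof: "Using axiom 3, by extending ā if necessary … so (x̄, e^x̄) must be generic in V over (ā, e^ā), so a fortiori over ā")] -/
theorem IsLinIndepExpAlgClosed.isStronglyExpAlgClosed (hac : IsAlgClosed K)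
    (hSP : SchanuelProperty K) (hLI : IsLinIndepExpAlgClosed K) :
    IsStronglyExpAlgClosed K := by
  classical
  haveI := hac
  intro n W hirr hne hrot hadd hmul hdim A F₀ hF₀
  -- Step 1 ("using axiom 3, by extending `ā` if necessary"): a strong hull `X ⊇ A ∪ F₀`,
  -- spanned by a finite set `T`
  set Λ' : Submodule ℚ K := Submodule.span ℚ (↑A ∪ ↑F₀ : Set K) with hΛ'
  have hbot : IsStrong (⊥ : Submodule ℚ K) :=
    ZilberHomogeneity.isStrong_bot_of_schanuelProperty hSP
  have hfgΛ' : IsFG (⊥ : Submodule ℚ K) Λ' :=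
    isFG_span_of_finite ⊥ (A.finite_toSet.union F₀.finite_toSet)
  obtain ⟨X, hΛ'X, hfgX, hX⟩ := hbot.exists_isStrong bot_le hfgΛ'
  obtain ⟨T, hTX, hXT⟩ := isFG_iff_exists_finset.1 hfgX
  have hT : Submodule.span ℚ (↑T : Set K) = X :=
    le_antisymm (Submodule.span_le.2 hTX) (by rwa [bot_sup_eq] at hXT)
  -- Step 2: the scheme, for the parameter set `T`
  obtain ⟨z, ⟨hzW, hzexp⟩, hzlin⟩ := hLI n W hirr hne hrot hadd hmul hdim T
  refine ⟨z, ⟨hzW, hzexp⟩, ?_⟩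
  set x : Fin n → K := z ∘ Sum.inl with hx
  have hz : z = gammaPt x := (mem_expGraph_iff_eq_gammaPt z).1 hzexp
  have hlin : LinIndepOver X x := ZilberSaturationMain.linIndepOver_of_forall_intCast T hT hzlin
  -- Step 3: `td(x/X) ≥ n` since `X ◁ K` and `ldim(x/X) = n`
  have hfg : IsFG X (Submodule.span ℚ (range x)) := isFG_span_of_finite X (finite_range x)
  have hδ : 0 ≤ predim X (Submodule.span ℚ (range x)) := (isStrong_iff.1 hX) _ hfg
  have hldim : ldim X (Submodule.span ℚ (range x)) = n := ldim_span_eq_of_linIndepOver hlin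
  have htd_ge : (n : ℕ∞) ≤ td X (Submodule.span ℚ (range x)) := by
    rw [predim_def, hldim] at hδ
    have h1 : n ≤ (td X (Submodule.span ℚ (range x))).toNat := by omega
    rw [← ENat.coe_toNat (td_ne_top hfg)]
    exact_mod_cast h1
  -- Step 4: the relative rank of the coordinates of `(x, eˣ)` over `k = ℚ(A ∪ F₀)` is `≥ n`
  set k : Subfield K := Subfield.closure (↑A ∪ ↑F₀ : Set K) with hk
  have hk_acl : (k : Set K) ⊆ (algMatroid K).closure (gens X) := by
    refine (subfieldClosure_subset_acl _).trans (acl_subset_acl_of_subset ?_)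
    intro a ha
    exact subset_acl _ (subset_gens X (hΛ'X (Submodule.subset_span ha)))
  have hrange : range z = range x ∪ exp '' range x := by
    rw [hz, ZilberSaturationMain.range_gammaPt]
  have hrel : (n : ℕ∞) ≤ (algMatroid K).relRank (k : Set K) (range z) :=
    calc (n : ℕ∞) ≤ td X (Submodule.span ℚ (range x)) := htd_ge
      _ ≤ (algMatroid K).relRank (gens X) (range x ∪ exp '' range x) :=
          td_span_le_relRank X (range x)
      _ = (algMatroid K).relRank ((algMatroid K).closure (gens X)) (range z) := by
          rw [hrange, Matroid.relRank_closure_left]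
      _ ≤ (algMatroid K).relRank (k : Set K) (range z) :=
          (algMatroid K).relRank_anti_left _ hk_acl
  -- Step 5: the prime `P = I(W) ∩ k[X, Y]` (coefficient extension `k[X, Y] → K[X, Y]` as an
  -- algebra, Mathlib's non-global instance `MvPolynomial.algebraMvPolynomial`, as in
  -- `LocusComponents.lean`)
  letI instAlg : Algebra (MvPolynomial (Fin n ⊕ Fin n) k) (MvPolynomial (Fin n ⊕ Fin n) K) :=
    MvPolynomial.algebraMvPolynomial
  haveI h𝔓 : (vanishingIdeal K W).IsPrime := hirr.2
  have hφp : ∀ p : MvPolynomial (Fin n ⊕ Fin n) k,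
      algebraMap (MvPolynomial (Fin n ⊕ Fin n) k) (MvPolynomial (Fin n ⊕ Fin n) K) p =
        MvPolynomial.map (algebraMap k K) p := fun _ => rfl
  set φ : MvPolynomial (Fin n ⊕ Fin n) k →+* MvPolynomial (Fin n ⊕ Fin n) K :=
    algebraMap (MvPolynomial (Fin n ⊕ Fin n) k) (MvPolynomial (Fin n ⊕ Fin n) K) with hφ
  set P : Ideal (MvPolynomial (Fin n ⊕ Fin n) k) := (vanishingIdeal K W).comap φ with hP
  have mem_P : ∀ p : MvPolynomial (Fin n ⊕ Fin n) k, p ∈ P ↔ ∀ w ∈ W, aeval w p = 0 := by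
    intro p
    rw [hP, Ideal.mem_comap, hφ, hφp, mem_vanishingIdeal_iff]
    refine forall₂_congr fun w _ => ?_
    rw [aeval_map_algebraMap]
  have hPW : P = vanishingIdeal k W := by
    ext p
    rw [mem_P, mem_vanishingIdeal_iff]
  have hPmap : P.map φ ≤ vanishingIdeal K W := Ideal.map_comap_le
  -- `W` is defined over `k ⊇ ℚ(F₀)`
  have hle : Subfield.closure (↑F₀ : Set K) ≤ k := Subfield.closure_mono subset_union_right
  obtain ⟨TW, hTW, hWT⟩ := IsDefinedOver.exists_subset_range_of_le hle hF₀
  -- `I(W)` is the unique minimal prime over `P·K[X, Y]`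
  have hmin : vanishingIdeal K W ∈ (P.map φ).minimalPrimes := by
    refine ⟨⟨h𝔓, hPmap⟩, ?_⟩
    rintro q ⟨hq, hPq⟩ hqle
    haveI := hq
    -- `Z(q) ⊆ W` because `W` is cut out by polynomials over `k`, which lie in `P`
    have hZqW : zeroLocus K q ⊆ W := by
      intro y hy
      rw [hWT]
      intro p hp
      obtain ⟨p₁, rfl⟩ := hTW hp
      have hp₁P : p₁ ∈ P := by
        rw [mem_P]
        intro w hw
        rw [← aeval_map_algebraMap K w p₁]
        rw [hWT] at hw
        exact hw _ hp
      have hmem : φ p₁ ∈ q := hPq (Ideal.mem_map_of_mem φ hp₁P)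
      rw [hφ, hφp] at hmem
      exact (mem_zeroLocus_iff.1 hy) _ hmem
    -- hence `I(W) ⊆ I(Z(q)) = q`
    rw [← MvPolynomial.IsPrime.vanishingIdeal_zeroLocus (K := K) q]
    exact vanishingIdeal_anti_mono hZqW
  -- `dim k[X, Y]/P = dim W = n`, hence `trdeg_k (k[X, Y]/P) = n`
  have hKdim : ringKrullDim (MvPolynomial (Fin n ⊕ Fin n) k ⧸ P) = n := by
    rw [← LocusComponents.ringKrullDim_quotient_eq_of_mem_minimalPrimes_map hmin]
    exact hdim
  have htr : Algebra.trdeg k (MvPolynomial (Fin n ⊕ Fin n) k ⧸ P) = n := by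
    have h1 := Literature.RingTheory.KrullDimension.ringKrullDim_eq_trdeg k
      (MvPolynomial (Fin n ⊕ Fin n) k ⧸ P)
    rw [hKdim] at h1
    have h2 : Cardinal.toNat (Algebra.trdeg k (MvPolynomial (Fin n ⊕ Fin n) k ⧸ P)) = n := by
      exact_mod_cast h1.symm
    rw [Literature.RingTheory.KrullDimension.trdeg_eq_toNat k (MvPolynomial (Fin n ⊕ Fin n) k ⧸ P),
      h2]
  -- Step 6: `z` is a zero of `P` of transcendence degree `≥ n` over `k`, hence generic
  have hzP : z ∈ zeroLocus K P := mem_zeroLocus_iff.2 fun p hp => (mem_P p).1 hp z hzW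
  have hgen : IsGenericPt P z := by
    refine LocusComponents.isGenericPt_of_trdeg_le P hzP ?_
    rw [htr]
    refine Cardinal.natCast_le_toENat.1 ?_
    rw [ZilberGSGC.toENat_trdeg_adjoin_subfield_eq_relRank]
    exact hrel
  refine ⟨hzW, ?_⟩
  rw [(isGenericPt_iff_vanishingIdeal_singleton_eq P z).1 hgen, hPW]

/-- **Kirby 2013, §2.3, Proposition** ("Thus axiom 4 is equivalent to this scheme, modulo axioms 1,
2, and 3") — the named fact `kirby2013_isStronglyExpAlgClosed_iff_isLinIndepExpAlgClosed` holds: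
for an algebraically closed exponential field of characteristic zero with surjective `exp`,
standard kernel and the Schanuel property, Zilber's strong exponential-algebraic closedness
(genericity form) is equivalent to Kirby's linear-independence scheme. (⟹ is
`IsStronglyExpAlgClosed.isLinIndepExpAlgClosed`, unconditionally; ⟸ is
`IsLinIndepExpAlgClosed.isStronglyExpAlgClosed`, using axioms 1 and 3 only.)
[cite: Kirby2013Axioms, §2.3, Proposition and its proof] -/
theorem kirby2013_isStronglyExpAlgClosed_iff_isLinIndepExpAlgClosed_holds :
    kirby2013_isStronglyExpAlgClosed_iff_isLinIndepExpAlgClosed K :=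
  fun hac _ _ hSP =>
    ⟨IsStronglyExpAlgClosed.isLinIndepExpAlgClosed, fun h => h.isStronglyExpAlgClosed hac hSP⟩

/-- **Zilber fields from Bays–Kirby's printed axioms** (Bays–Kirby 2018, Thm 9.1, axioms 1–5 with
axiom 4 in the linear-independence form and axiom 5 for finite sets): an exponential field
satisfying them is a Zilber field in the sense of `IsZilberField` (Zilber 2005 / Kirby 2013 §2,
axiom 4 in genericity form, CCP for countable sets), by Kirby's Proposition and the finite
character of `ecl` (`hasCountableClosureProperty_iff_finite`).
[cite: BaysKirby2018ANT, Thm 9.1 (axioms 1–5)] [cite: Kirby2013Axioms, §2.3, Proposition] -/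
theorem IsZilberField.of_thm91_axioms (hac : IsAlgClosed K) (hsurj : IsSurjectiveOntoUnits K)
    (hker : HasStandardKernel K) (hSP : SchanuelProperty K) (hLI : IsLinIndepExpAlgClosed K)
    (hccp : ∀ X : Set K, X.Finite → (ecl X).Countable) : IsZilberField K :=
  IsZilberField.of_isLinIndepExpAlgClosed
    kirby2013_isStronglyExpAlgClosed_iff_isLinIndepExpAlgClosed_holds hac hker hsurj hSP hLI
    (hasCountableClosureProperty_iff_finite.2 hccp)

end Kirby2013

/-! ### Axiom 3 over the base `SK`: strongness of `ℚτ` is the Schanuel property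

Bays–Kirby 2018, proof of Thm 9.1 (p. 28): "note that axioms 2 and 3 are slightly different from
the axioms given in the statement of Theorem 8.2. The Schanuel property holds on our choice of
`F_base` because `τ` is transcendental, and it follows from the addition property for `δ` that the
two versions of axiom 3 are equivalent in this case." Axiom 3 of Thm 8.2 is `F_base ◁ F`, i.e. in
the vocabulary of `GammaFields.lean` `IsStrong (span_ℚ {τ})`; axiom 3 of Thm 9.1 is the Schanuel
property, i.e. `IsStrong ⊥` (`ZilberHomogeneity.isStrong_bot_of_schanuelProperty` and its converse
`schanuelProperty_of_isStrong_bot` below). This is the form in which the large models of the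
quasiminimal class deliver axiom 3 (`Literature/ModelTheory/Quasiminimal/ContinuumStrong.lean`:
strongness of the base is preserved), so the assembly of `exists_isZilberField_of_aleph0_lt` from
them goes through `IsZilberField.of_isStrong_span_kernelGenerator` below. -/

section StrongBase

open GammaField Matroid

variable {F : Type u} [Field F] [CharZero F] [ExponentialRing F]

omit [ExponentialRing F] in
/-- **Rank in the algebraic matroid versus `Algebra.trdeg` over `ℚ`** (converse of
`ZilberHomogeneity.natCast_le_eRk_of_le_trdeg`): if `T` has rank at least `n` then `ℚ(T)` has
transcendence degree at least `n` over `ℚ` (a basis of `T` in the algebraic matroid is a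
`ℚ`-algebraically independent subset of `ℚ(T)`). [folklore] -/
theorem le_trdeg_adjoin_of_natCast_le_eRk {T : Set F} {n : ℕ}
    (h : (n : ℕ∞) ≤ (algMatroid F).eRk T) :
    (n : Cardinal) ≤ Algebra.trdeg ℚ ↥(IntermediateField.adjoin ℚ T) := by
  classical
  obtain ⟨I, hI⟩ := (algMatroid F).exists_isBasis' T
  have hIT : I ⊆ T := hI.subset
  have hind : AlgebraicIndepOn ℚ _root_.id I := AlgebraicIndependent.matroid_indep_iff.1 hI.indep
  set E₁ : IntermediateField ℚ F := IntermediateField.adjoin ℚ T with hE₁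
  have hIE : ∀ i : I, (i : F) ∈ E₁ := fun i => IntermediateField.subset_adjoin ℚ T (hIT i.2)
  let v : I → E₁ := fun i => ⟨i, hIE i⟩
  have hv : AlgebraicIndependent ℚ v := AlgebraicIndependent.of_comp E₁.val hind
  have h1 : #I ≤ Algebra.trdeg ℚ E₁ := hv.cardinalMk_le_trdeg
  have h2 : (n : Cardinal) ≤ #I := by
    refine Cardinal.natCast_le_toENat.1 ?_
    rw [Set.toENat_cardinalMk, hI.encard_eq_eRk]
    exact h
  exact h2.trans h1

omit [ExponentialRing F] in
/-- A `ℚ`-linearly independent tuple is linearly independent over the zero subspace.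
[folklore] -/
theorem linIndepOver_bot_of_linearIndependent {n : ℕ} {x : Fin n → F}
    (hx : LinearIndependent ℚ x) : LinIndepOver (⊥ : Submodule ℚ F) x := by
  intro q hq
  rw [Submodule.mem_bot] at hq
  exact funext ((Fintype.linearIndependent_iff.1 hx) q hq)

/-- **Strongness of the zero subspace is the Schanuel property** (converse of
`ZilberHomogeneity.isStrong_bot_of_schanuelProperty`; Bays–Kirby 2018, §9.1: "The predimension
inequality is precisely Schanuel's conjecture"): if `δ(x̄/0) ≥ 0` for all finite tuples then every
`ℚ`-linearly independent `x̄` has `td(x̄, exp x̄) ≥ n`. [cite: BaysKirby2018ANT, §9.1 and Thm 9.1 (proof)] -/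
theorem schanuelProperty_of_isStrong_bot (h : IsStrong (⊥ : Submodule ℚ F)) :
    SchanuelProperty F := by
  classical
  intro n x hx
  set Λ' : Submodule ℚ F := Submodule.span ℚ (range x) with hΛ'
  have hfg : IsFG (⊥ : Submodule ℚ F) Λ' := isFG_span_of_finite ⊥ (finite_range x)
  have hδ : 0 ≤ predim (⊥ : Submodule ℚ F) Λ' := (isStrong_iff.1 h) Λ' hfg
  have hldim : ldim (⊥ : Submodule ℚ F) Λ' = n :=
    ldim_span_eq_of_linIndepOver (linIndepOver_bot_of_linearIndependent hx)
  have htd : (n : ℕ∞) ≤ td (⊥ : Submodule ℚ F) Λ' := by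
    rw [predim_def, hldim] at hδ
    have h1 : n ≤ (td (⊥ : Submodule ℚ F) Λ').toNat := by omega
    rw [← ENat.coe_toNat (td_ne_top hfg)]
    exact_mod_cast h1
  -- `td(Λ'/0) = rk (gens Λ') ≤ rk (x ∪ exp x)`
  have hsub : gens Λ' ⊆ (algMatroid F).closure (range x ∪ range (exp ∘ x)) := by
    have h1 := gens_sup_span_subset_acl (⊥ : Submodule ℚ F) (range x)
    rw [bot_sup_eq] at h1
    refine h1.trans (acl_subset_acl_of_subset ?_)
    rintro a (ha | ha | ha)
    · have ha' : a ∈ (algMatroid F).closure (gens (⊥ : Submodule ℚ F)) := subset_acl _ ha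
      rw [ZilberHomogeneity.closure_gens_bot] at ha'
      exact (algMatroid F).closure_subset_closure (empty_subset _) ha'
    · exact subset_acl _ (Or.inl ha)
    · exact subset_acl _ (Or.inr (by rwa [range_comp]))
  have hrk : td (⊥ : Submodule ℚ F) Λ' ≤ (algMatroid F).eRk (range x ∪ range (exp ∘ x)) := by
    rw [ZilberHomogeneity.td_bot, ← (algMatroid F).eRk_closure_eq (range x ∪ range (exp ∘ x))]
    exact (algMatroid F).eRk_mono hsub
  exact le_trdeg_adjoin_of_natCast_le_eRk (htd.trans hrk)

/-- **The Schanuel property is strongness of `0`** (`0 ◁ F`), both directions.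
[cite: BaysKirby2018ANT, §9.1 and Thm 9.1 (proof)] -/
theorem schanuelProperty_iff_isStrong_bot :
    SchanuelProperty F ↔ IsStrong (⊥ : Submodule ℚ F) :=
  ⟨ZilberHomogeneity.isStrong_bot_of_schanuelProperty, schanuelProperty_of_isStrong_bot⟩

/-- The generators `ℚτ ∪ exp(ℚτ)` of the Γ-field of `ℚτ`, for `exp τ = 1`, are algebraic over
`τ`: the exponentials are roots of unity. [folklore] -/
theorem closure_gens_span_kernelGenerator {τ : F} (hexp : exp τ = 1) :
    (algMatroid F).closure (gens (Submodule.span ℚ {τ})) = (algMatroid F).closure {τ} := by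
  refine Subset.antisymm ((algMatroid F).closure_subset_closure_of_subset_closure ?_)
    ((algMatroid F).closure_subset_closure ?_)
  · rintro a (ha | ⟨b, hb, rfl⟩)
    · obtain ⟨q, rfl⟩ := Submodule.mem_span_singleton.1 ha
      exact smul_mem_acl q (subset_acl _ (mem_singleton τ))
    · obtain ⟨q, rfl⟩ := Submodule.mem_span_singleton.1 hb
      refine exp_smul_mem_acl q ?_
      rw [hexp]
      exact one_mem_acl _
  · intro a ha
    rw [mem_singleton_iff.1 ha]
    exact mem_gens_of_mem (Submodule.mem_span_singleton_self τ)

/-- `δ(ℚτ/0) = 0` for a transcendental kernel generator `τ` (`td(τ, 1) = 1 = ldim`).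
[cite: BaysKirby2018ANT, Thm 9.1 (proof: "The Schanuel property holds on our choice of F_base because τ is transcendental")] -/
theorem predim_bot_span_kernelGenerator {τ : F} (hτ : Transcendental ℚ τ) (hexp : exp τ = 1) :
    predim (⊥ : Submodule ℚ F) (Submodule.span ℚ {τ}) = 0 := by
  classical
  have hτ0 : τ ≠ 0 := fun h0 => hτ (h0 ▸ isAlgebraic_zero)
  have hldim : ldim (⊥ : Submodule ℚ F) (Submodule.span ℚ {τ}) = 1 :=
    ldim_span_singleton_of_not_mem (by rwa [Submodule.mem_bot])
  have hind : (algMatroid F).Indep {τ} := by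
    rw [AlgebraicIndependent.matroid_indep_iff]
    exact (algebraicIndependent_singleton_iff (⟨τ, mem_singleton τ⟩ : ({τ} : Set F))).2 hτ
  have htd : td (⊥ : Submodule ℚ F) (Submodule.span ℚ {τ}) = 1 := by
    rw [ZilberHomogeneity.td_bot, ← (algMatroid F).eRk_closure_eq,
      closure_gens_span_kernelGenerator hexp, (algMatroid F).eRk_closure_eq, hind.eRk_eq_encard,
      encard_singleton]
  rw [predim_def, htd, hldim]
  rfl

/-- `δ(Y + ℚτ / Y) ≤ 0` for a kernel element `τ` (`exp τ = 1`): the extension is generated by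
`τ` alone up to roots of unity. [folklore] -/
theorem predim_sup_span_kernelElement_le {τ : F} (hexp : exp τ = 1) (Y : Submodule ℚ F) :
    predim Y (Y ⊔ Submodule.span ℚ {τ}) ≤ 0 := by
  classical
  rw [predim_sup_left]
  by_cases hτY : τ ∈ Y
  · rw [predim_eq_zero_of_le ((Submodule.span_singleton_le_iff_mem τ Y).2 hτY)]
  · have hldim : ldim Y (Submodule.span ℚ {τ}) = 1 := ldim_span_singleton_of_not_mem hτY
    have htd : td Y (Submodule.span ℚ {τ}) ≤ 1 := by
      rw [td_def]
      calc (algMatroid F).relRank (gens Y) (gens (Submodule.span ℚ {τ}))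
          ≤ (algMatroid F).relRank (gens Y) {τ} := by
            refine (algMatroid F).relRank_le_of_subset_closure (gens Y) ?_
            refine ((algMatroid F).subset_closure _).trans ?_
            rw [closure_gens_span_kernelGenerator hexp]
            exact (algMatroid F).closure_subset_closure subset_union_left
        _ ≤ ({τ} \ gens Y).encard := (algMatroid F).relRank_le_encard_diff _ _
        _ ≤ ({τ} : Set F).encard := encard_le_encard sdiff_subset
        _ = 1 := encard_singleton τ
    have hfg : IsFG Y (Submodule.span ℚ {τ}) := isFG_span_of_finite Y (finite_singleton τ)
    have h1 : (td Y (Submodule.span ℚ {τ})).toNat ≤ 1 := by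
      have h2 : ((td Y (Submodule.span ℚ {τ})).toNat : ℕ∞) ≤ 1 := by
        rw [ENat.coe_toNat (td_ne_top hfg)]
        exact htd
      exact_mod_cast h2
    rw [predim_def, hldim]
    omega

/-- **Axiom 3 of Thm 8.2 implies axiom 3 of Thm 9.1** (Bays–Kirby 2018, proof of Thm 9.1: "it
follows from the addition property for `δ` that the two versions of axiom 3 are equivalent"):
if `exp τ = 1` with `τ` transcendental and `ℚτ ◁ F`, then `0 ◁ F`. Proof: for `Y` finitely
generated, `δ(Y/0) = δ(Y + ℚτ/0) - δ(Y + ℚτ/Y) ≥ δ(Y + ℚτ/0) = δ(ℚτ/0) + δ(Y + ℚτ/ℚτ) ≥ 0 + 0`.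
[cite: BaysKirby2018ANT, Thm 9.1 (proof)] -/
theorem isStrong_bot_of_isStrong_span_kernelGenerator {τ : F} (hτ : Transcendental ℚ τ)
    (hexp : exp τ = 1) (h : IsStrong (Submodule.span ℚ {τ})) : IsStrong (⊥ : Submodule ℚ F) := by
  classical
  intro Y _ hfg
  set T : Submodule ℚ F := Submodule.span ℚ {τ} with hT
  have hfgT : IsFG (⊥ : Submodule ℚ F) T := isFG_span_of_finite ⊥ (finite_singleton τ)
  have hfgZ : IsFG (⊥ : Submodule ℚ F) (Y ⊔ T) := hfg.sup hfgT
  -- `δ(Y + ℚτ/0) = δ(ℚτ/0) + δ(Y + ℚτ/ℚτ) ≥ 0`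
  have h1 : predim (⊥ : Submodule ℚ F) (Y ⊔ T) =
      predim (⊥ : Submodule ℚ F) T + predim T (Y ⊔ T) :=
    predim_add bot_le le_sup_right hfgZ
  have h2 : 0 ≤ predim T (Y ⊔ T) := h le_sup_right (hfgZ.of_le_left bot_le)
  have h3 : predim (⊥ : Submodule ℚ F) T = 0 := predim_bot_span_kernelGenerator hτ hexp
  -- `δ(Y + ℚτ/0) = δ(Y/0) + δ(Y + ℚτ/Y)` and `δ(Y + ℚτ/Y) ≤ 0`
  have h4 : predim (⊥ : Submodule ℚ F) (Y ⊔ T) =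
      predim (⊥ : Submodule ℚ F) Y + predim Y (Y ⊔ T) :=
    predim_add bot_le le_sup_left hfgZ
  have h5 : predim Y (Y ⊔ T) ≤ 0 := predim_sup_span_kernelElement_le hexp Y
  omega

/-- Conversely, **`0 ◁ F` implies `ℚτ ◁ F`** for a transcendental kernel generator `τ`:
`δ(Y/ℚτ) = δ(Y/0) - δ(ℚτ/0) = δ(Y/0) ≥ 0` for `Y ⊇ ℚτ` (Bays–Kirby 2018, proof of Thm 9.1:
"Since `τ` is transcendental and the kernel is standard, it follows that `F_base` embeds strongly
in `F`"). Together with `isStrong_bot_of_isStrong_span_kernelGenerator`: in the presence of a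
standard kernel, axiom 3 of Thm 8.2 (`SK ◁ F`) and axiom 3 of Thm 9.1 (the Schanuel property) are
equivalent. [cite: BaysKirby2018ANT, Thm 9.1 (proof)] -/
theorem isStrong_span_kernelGenerator_of_isStrong_bot {τ : F} (hτ : Transcendental ℚ τ)
    (hexp : exp τ = 1) (h : IsStrong (⊥ : Submodule ℚ F)) : IsStrong (Submodule.span ℚ {τ}) := by
  intro Y hle hfg
  have hfg0 : IsFG (⊥ : Submodule ℚ F) Y :=
    (isFG_span_of_finite (⊥ : Submodule ℚ F) (finite_singleton τ)).trans hfg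
  have h1 : predim (⊥ : Submodule ℚ F) Y =
      predim (⊥ : Submodule ℚ F) (Submodule.span ℚ {τ}) + predim (Submodule.span ℚ {τ}) Y :=
    predim_add bot_le hle hfg0
  have h2 : 0 ≤ predim (⊥ : Submodule ℚ F) Y := h bot_le hfg0
  have h3 : predim (⊥ : Submodule ℚ F) (Submodule.span ℚ {τ}) = 0 :=
    predim_bot_span_kernelGenerator hτ hexp
  omega

/-- **Axiom 3 of Thm 9.1 versus axiom 3 of Thm 8.2**: for a transcendental `τ` with `exp τ = 1`,
the Schanuel property holds iff `ℚτ ◁ F`. [cite: BaysKirby2018ANT, Thm 9.1 (proof)] -/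
theorem schanuelProperty_iff_isStrong_span_kernelGenerator {τ : F} (hτ : Transcendental ℚ τ)
    (hexp : exp τ = 1) : SchanuelProperty F ↔ IsStrong (Submodule.span ℚ {τ}) := by
  rw [schanuelProperty_iff_isStrong_bot]
  exact ⟨isStrong_span_kernelGenerator_of_isStrong_bot hτ hexp,
    isStrong_bot_of_isStrong_span_kernelGenerator hτ hexp⟩

/-- **Zilber fields from the axioms of Bays–Kirby's Thm 8.2 over the base `SK`** (axiom 2: the
kernel of `exp` is `τℤ` with `τ` transcendental; axiom 3: `ℚτ ◁ F`; axiom 4 in the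
linear-independence form; axiom 5 for finite sets), via
`isStrong_bot_of_isStrong_span_kernelGenerator`, `schanuelProperty_of_isStrong_bot` and
`IsZilberField.of_thm91_axioms`. [cite: BaysKirby2018ANT, Thm 8.2 (axioms 1–5) and Thm 9.1 (proof)] -/
theorem IsZilberField.of_isStrong_span_kernelGenerator (hac : IsAlgClosed F)
    (hsurj : IsSurjectiveOntoUnits F) {τ : F} (hτ : Transcendental ℚ τ)
    (hker : expKernel F = AddSubgroup.zmultiples τ) (hstrong : IsStrong (Submodule.span ℚ {τ}))
    (hLI : IsLinIndepExpAlgClosed F) (hccp : ∀ X : Set F, X.Finite → (ecl X).Countable) :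
    IsZilberField F := by
  have hexp : exp τ = 1 := by
    rw [← mem_expKernel_iff, hker]
    exact AddSubgroup.mem_zmultiples τ
  exact IsZilberField.of_thm91_axioms hac hsurj ⟨τ, hτ, hker⟩
    (schanuelProperty_of_isStrong_bot
      (isStrong_bot_of_isStrong_span_kernelGenerator hτ hexp hstrong)) hLI hccp

/-- **Axiom 4 over a base contains Kirby's scheme**: strong exponential-algebraic closedness over
`B ∪ ā` for every finite `ā` (Bays–Kirby 2018, Thm 8.2 axiom 4: "`b` is `ℚ`-linearly independent
over `Γ(F_base) ∪ a`") implies the scheme `IsLinIndepExpAlgClosed` (independence over `ā` alone).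
[cite: BaysKirby2018ANT, Thm 8.2 (axiom 4)] -/
theorem isLinIndepExpAlgClosed_of_base (B : Set F)
    (h4 : ∀ (n : ℕ) (W : Set (Fin n ⊕ Fin n → F)), IsIrreducibleClosed F W →
      (W ∩ torusLocus F n).Nonempty → IsRotund F n (W ∩ torusLocus F n) →
      IsAddFree F n (W ∩ torusLocus F n) → IsMulFree F n (W ∩ torusLocus F n) →
      zariskiDim F W = n →
      ∀ A : Finset F, ∃ z ∈ W ∩ expGraph F n,
        ∀ m : Fin n → ℤ, (∑ i, (m i : F) * z (Sum.inl i)) ∈ Submodule.span ℚ (B ∪ ↑A) → m = 0) :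
    IsLinIndepExpAlgClosed F := by
  intro n W hirr hne hrot hadd hmul hdim A
  obtain ⟨z, hz, hlin⟩ := h4 n W hirr hne hrot hadd hmul hdim A
  exact ⟨z, hz, fun m hm => hlin m (Submodule.span_mono subset_union_right hm)⟩

end StrongBase

/-! ### Reduction of the existence theorem to Bays–Kirby's Theorem 9.1 (printed form) -/

section Existence

/-- **Zilber's existence theorem from Bays–Kirby's Theorem 9.1 as printed.** Bays–Kirby 2018,
Thm 1.2 = Thm 9.1 (arXiv v4 p. 28): "Up to isomorphism, there is exactly one model
`⟨F; +, ·, exp⟩` of each uncountable cardinality of the following list `ECF_{SK,CCP}` of axioms.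
1. ELA-field … 2. Standard kernel … 3. Schanuel Property … 4. Strong exponential-algebraic
closedness [there is `x̄` in `F` such that `(x̄, e^x̄) ∈ V` and `x̄` is `ℚ`-linearly independent
over `ā`] … 5. Countable Closure Property [for each finite subset `X` of `F`, `ecl^F(X)` is
countable]." Granted its existence half in exactly this form (hypothesis `h`; its proof is the
body of the paper: the countable model `M(SK)`, Thm 5.9; its quasiminimal pregeometry structure,
Thm 6.9; the models of all uncountable cardinalities of the quasiminimal class, Fact 6.4 =
Bays–Hart–Hyttinen–Kesälä–Kirby 2014 Thm 2.3 / Kirby 2010 Thm 4.2; and their axioms, Thm 8.2 —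
of which the tree has so far the passage from a countable chart to the model of cardinality `𝔠`,
`Literature/ModelTheory/Quasiminimal/Continuum*.lean`), the tree's named fact
`exists_isZilberField_of_aleph0_lt` (Zilber field = axiom 4 in Zilber's genericity form) follows
by `IsZilberField.of_thm91_axioms`, i.e. by Kirby 2013 §2.3.
[cite: BaysKirby2018ANT, Thm 1.2 = Thm 9.1 (existence half)] [cite: Zilber2005PseudoExp, Thm 1.1] -/
theorem exists_isZilberField_of_aleph0_lt_of_thm91
    (h : ∀ κ : Cardinal.{0}, ℵ₀ < κ →
      ∃ (F : Type) (_ : Field F) (_ : CharZero F) (_ : ExponentialRing F),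
        IsAlgClosed F ∧ IsSurjectiveOntoUnits F ∧ HasStandardKernel F ∧ SchanuelProperty F ∧
          IsLinIndepExpAlgClosed F ∧ (∀ X : Set F, X.Finite → (ecl X).Countable) ∧ #F = κ) :
    exists_isZilberField_of_aleph0_lt := by
  intro κ hκ
  obtain ⟨F, _, _, _, hac, hsurj, hker, hSP, hLI, hccp, hcard⟩ := h κ hκ
  exact ⟨F, inferInstance, inferInstance, inferInstance,
    IsZilberField.of_thm91_axioms hac hsurj hker hSP hLI hccp, hcard⟩

/-- **Zilber's existence theorem from the large models of Bays–Kirby's quasiminimal class, in the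
form in which the tree produces them.** The route of Bays–Kirby 2018 to Thm 1.2 = Thm 9.1 is: the
countable model `M(SK)` (Thm 5.9, Notation 5.10); its quasiminimal pregeometry structure
(Thm 6.9); the structures of every uncountable cardinality in the quasiminimal class `𝒦(M(SK))`
(Fact 6.4 = Bays–Hart–Hyttinen–Kesälä–Kirby 2014 Thm 2.3, Kirby 2010 Thm 4.2: unions of directed
systems of closed embeddings of `M(SK)`); and their axioms (Thm 8.2: ELA; the base `SK` and its
kernel `τℤ`; `SK ◁ F`; strong exponential-algebraic closedness over `Γ(SK) ∪ ā` in the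
linear-independence form; the countable closure property for finite sets). The tree has the last
two stages for the cardinal `𝔠` (`Literature/ModelTheory/Quasiminimal/ContinuumAssembly.lean`,
`Setup.exists_continuumModel_over_base`, whose conclusion has exactly the shape of the hypothesis
`h` below with `#F = 𝔠`). Granted that output for every uncountable `κ` (hypothesis `h`: its
remaining inputs are the countable chart — Thm 5.9 + Thm 6.9 — and the passage from `Finset ℝ` to
finite subsets of a set of cardinality `κ` in `LargeModels.lean`/`SelfEmbeddings.lean`, which are
already index-general), the named fact follows from `IsZilberField.of_isStrong_span_kernelGenerator`
(axiom 3 of Thm 8.2 ⟹ Schanuel property; Kirby's scheme ⟹ SEAC, Kirby 2013 §2.3).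
[cite: BaysKirby2018ANT, Thm 1.2, Fact 6.4, Thm 6.9, Thm 8.2, Thm 9.1] [cite: Kirby2010QMEC, Thm 4.2] -/
theorem exists_isZilberField_of_aleph0_lt_of_largeModels
    (h : ∀ κ : Cardinal.{0}, ℵ₀ < κ →
      ∃ (F : Type) (_ : Field F) (_ : CharZero F) (_ : ExponentialRing F) (τ : F),
        #F = κ ∧ IsAlgClosed F ∧ IsSurjectiveOntoUnits F ∧ Transcendental ℚ τ ∧
        expKernel F = AddSubgroup.zmultiples τ ∧ GammaField.IsStrong (Submodule.span ℚ {τ}) ∧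
        (∀ (n : ℕ) (W : Set (Fin n ⊕ Fin n → F)), IsIrreducibleClosed F W →
          (W ∩ torusLocus F n).Nonempty → IsRotund F n (W ∩ torusLocus F n) →
          IsAddFree F n (W ∩ torusLocus F n) → IsMulFree F n (W ∩ torusLocus F n) →
          zariskiDim F W = n →
          ∀ A : Finset F, ∃ z ∈ W ∩ expGraph F n,
            ∀ m : Fin n → ℤ, (∑ i, (m i : F) * z (Sum.inl i)) ∈
              Submodule.span ℚ ({τ} ∪ ↑A) → m = 0) ∧
        (∀ X : Set F, X.Finite → (ecl X).Countable)) :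
    exists_isZilberField_of_aleph0_lt := by
  intro κ hκ
  obtain ⟨F, _, _, _, τ, hcard, hac, hsurj, hτ, hker, hstrong, h4, hccp⟩ := h κ hκ
  exact ⟨F, inferInstance, inferInstance, inferInstance,
    IsZilberField.of_isStrong_span_kernelGenerator hac hsurj hτ hker hstrong
      (isLinIndepExpAlgClosed_of_base {τ} h4) hccp, hcard⟩

end Existence

end Literature.NumberTheory.Transcendental
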